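import Literature.NumberTheory.EllipticCurves.KrizLi2019.EisensteinHeegnerLog
import Literature.NumberTheory.EllipticCurves.PastenValuationProductThm115Proofs
import Literature.NumberTheory.EllipticCurves.TamagawaNeZeroProofs
import Summits.BirchSwinnertonDyer.Rank1Residual.X11b.BDPRouteRankOneBookkeeping
import Summits.BirchSwinnertonDyer.Rank1Residual.O5.HeegnerLogTransportThreeKrizLiGlue
import Summits.BirchSwinnertonDyer.Rank1Residual.Additive.LocalLogImageRat
import HarnessLib

/-!
# O11 at an additive Eisenstein prime, ROUTE U — T-U2′: the Heegner INDEX is a `p`-UNIT when the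
# Manin constant is (`ord_p [E(K) : ℤP] = 0 = ord_p c`), WITHOUT the level-zero generator `hg0`

HONEST FRAMING (cell `bsd-cm`, run/shared/lean/pub/bsd-cm/, verbatim): the programme isolates, for
CM elliptic curves over `ℚ` of analytic rank `≤ 1`, classes on which the FULL BSD formula is
reduced — strictly by PUBLISHED theorems entering as named-fact binders — to ONE local problem at
ONE prime, and then TYPES that residual problem. Seat `bsd-cm-ram` (generation 4); planner ruling
D27 / TARGET R185 (B) «T-U2′: `hg0 ↦ hc7`». THEOREMS ONLY (no definition, no named fact, nothing
asserted about any curve; no label moves).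

## What is here

T-U2 (`RouteU.padicValNat_index_eq_padicValInt_manin_of_norm_eq_one`, file `RouteUHeegnerIndex`)
turns the UNIT statement `‖(|Ẽ^{ns}(𝔽_p)|/p) · log_{ω_E} P / c‖_p = 1` (Kriz–Li Thm. 1.20 ∧ Rem.
3.10) into `ord_p [E(K) : ℤP] = ord_p c` under the hypothesis `hg0 : ‖log_{ω_E} g‖_p = 1` on a
generator `g` of `E(K)/tors` ("level zero", `n(D) = 0`). This file REMOVES `hg0` when `p ∤ c`:

* `RouteU.norm_padicLogOmega_le_one_of_addv` — **at an ADDITIVE prime `p ≥ 5` of the globally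
  minimal `W/ℚ`, `‖log_{ω_E} x‖_p ≤ 1` for every `x ∈ E(K)`** (any number field `K ↪ ℚ_p`):
  `log_{ω_E} = padicLog ∘ (x ↦ x_ι)` (O5's `padicLogOmega_eq_padicLog`) and
  `log(E(ℚ_p)) = p^t ℤ_p ⊆ ℤ_p` (`Additive.LocalLog.range_padicLog_baseChange_of_addv_of_not_dvd`,
  Kim's Lemma 3.10 regime `p ∤ c_p`, which holds because `c_p ≤ 4 < p` at an additive prime:
  Kodaira–Néron `localTamagawaNumber_padic_le_four` + `localTamagawaNumber_padic_ne_zero_holds`).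
* `RouteU.padicValNat_index_eq_zero_of_not_dvd_manin` — **T-U2′**: T-U2's binders MINUS `hg0`,
  PLUS `hadd : Addv W p`, `5 ≤ p`, `hc : ¬ p ∣ c`; conclusion `ord_p [E(K) : ℤP] = 0`
  (and `…_eq_padicValInt_manin_of_not_dvd`: `= ord_p c`, the shape of T-U0's binder `hI`).
  Proof: the unit statement gives `ord_p log_{ω_E} P = ord_p c = 0`; `P = (crd P)·g + torsion`
  gives `log_{ω_E} P = (crd P)·log_{ω_E} g` with BOTH factors `p`-integral (`crd P ∈ ℤ`; the first
  bullet); so `ord_p (crd P) = 0 = ord_p log_{ω_E} g`, and `ord_p [E(K):ℤP] = ord_p |crd P|`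
  (x11b's `RankOne.padicValNat_index_zmultiples_eq`).

For ROUTE U proper (`p = 7`, `W` a minimal model of `49a1^{(D)}`, additive at `7`): the Manin
constant of the optimal curve is a `7`-unit in print for `N ≤ 130000` (Agashe–Ribet–Stein 2006,
Thm. 2.6), so the member files can display `hc7 : ¬ 7 ∣ D.c` instead of the data-dependent `hg0`.
What this file does NOT do: prove Thm. 1.20 / Rem. 3.10 (named facts), or anything about `c`.

References: [KrizLi2019] Thm. 1.20, Rem. 1.17, Rem. 3.10, §10.3; [Kim2022StructureSelmer] Lemma
3.10 / Rem. 3.8; [SilvermanATAEC1994] Cor. IV.9.2(d); [SilvermanAEC2009] IV.6.4, VII.6.1, VII.6.3;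
[AgasheRibetStein2006] Thm. 2.6.
-/

noncomputable section

open scoped Classical
open NumberField WeierstrassCurve IsDedekindDomain Literature.NumberTheory.EllipticCurves
open Literature.NumberTheory.EllipticCurves.ModularForms
open Literature.NumberTheory.EllipticCurves.Rank1Residual (Addv)

namespace Summit.BirchSwinnertonDyer.Rank1Residual.X12.O11.RouteU

/-- **At an additive prime `p ≥ 5`, `log_{ω_E}` is `p`-integral on `E(K)`**: for `W/ℚ` globally
minimal with `Addv W p`, `5 ≤ p`, any number field `K` with `ιp : K →+* ℚ_p` and any `x ∈ E(K)`,
`‖log_{ω_E} x_ιp‖_p ≤ 1`. Kodaira–Néron gives `c_p ≤ 4 < p` (no split multiplicative reduction at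
an additive prime), so Kim's Lemma 3.10 regime applies: `log(E(ℚ_p)) = p^t ℤ_p ⊆ ℤ_p`.
[cite: Kim2022StructureSelmer, Lemma 3.10 and Remark 3.8 (PDF pp. 16–17)]
[cite: SilvermanATAEC1994, Cor. IV.9.2(d) (PDF p. 340)] -/
theorem norm_padicLogOmega_le_one_of_addv
    (W : WeierstrassCurve ℚ) [W.IsElliptic] [W.IsGloballyMinimal] (p : ℕ) [Fact p.Prime]
    (hadd : Addv W p) (hp : 5 ≤ p)
    {K : Type} [Field K] [NumberField K] (ιp : K →+* ℚ_[p])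
    (x : (W.baseChange K).toAffine.Point) :
    ‖Castella2018.padicLogOmega W p ιp x‖ ≤ 1 := by
  -- `c_p ≤ 4 < p`, so `p ∤ c_p`
  have hcp : ¬ p ∣ (W.baseChange ℚ_[p]).localTamagawaNumber ℤ_[p] := by
    have h4 : (W.baseChange ℚ_[p]).localTamagawaNumber ℤ_[p] ≤ 4 :=
      localTamagawaNumber_padic_le_four p (W.baseChange ℚ_[p])
        (fun h => hadd.2 h.toHasMultiplicativeReduction)
    have h0 : (W.baseChange ℚ_[p]).localTamagawaNumber ℤ_[p] ≠ 0 :=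
      WeierstrassCurve.localTamagawaNumber_padic_ne_zero_holds p (W.baseChange ℚ_[p])
    intro hdvd
    have := Nat.le_of_dvd (Nat.pos_of_ne_zero h0) hdvd
    omega
  -- `log(E(ℚ_p)) = p^t ℤ_p`
  have hrange := Additive.LocalLog.range_padicLog_baseChange_of_addv_of_not_dvd W p hadd hcp
  have hmem : Castella2018.padicLogOmega W p ιp x ∈
      (Additive.LocalLog.padicLog (W.baseChange ℚ_[p])).range := by
    rw [O5.HeegnerLogTransport.padicLogOmega_eq_padicLog]
    exact ⟨_, rfl⟩
  rw [hrange] at hmem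
  change Castella2018.padicLogOmega W p ιp x ∈ Submodule.span ℤ_[p] _ at hmem
  obtain ⟨r, hr⟩ := Submodule.mem_span_singleton.mp hmem
  rw [← hr]
  change ‖(r : ℚ_[p]) * (p : ℚ_[p]) ^ _‖ ≤ 1
  rw [norm_mul, norm_pow]
  have h1 : ‖(r : ℚ_[p])‖ ≤ 1 := r.2
  have h2 : ‖(p : ℚ_[p])‖ ^ padicValNat p
      (Nat.card (AddCommGroup.torsion (W.baseChange ℚ_[p]).toAffine.Point)) ≤ 1 :=
    pow_le_one₀ (norm_nonneg _) (le_of_lt (Padic.norm_p_lt_one))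
  calc ‖(r : ℚ_[p])‖ * ‖(p : ℚ_[p])‖ ^ _ ≤ 1 * 1 := by gcongr
    _ = 1 := one_mul 1

/-- **T-U2′ (prime-generic, class-free): the Heegner index is a `p`-unit when the Manin constant
is.** T-U2's binders (`W/ℚ` globally minimal, `|Ẽ^{ns}(𝔽_p)| = p`, a modular parametrisation `D`
with constant `c = D.c`, `ιp : K → ℚ_p`, `P ∈ E(K)`, rank-one coordinate data `crd`/`g` with
kernel = torsion, no `p`-torsion in `E(K)`) WITHOUT the level-zero hypothesis `‖log_{ω_E} g‖ = 1`,
but with `Addv W p`, `5 ≤ p` and `p ∤ c`: the unit statement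
`‖(|Ẽ^{ns}(𝔽_p)|/p) · log_{ω_E} P / c‖_p = 1` (= Kriz–Li Thm. 1.20 ∧ Rem. 3.10) gives
**`ord_p [E(K) : ℤP] = 0`**. (`ord_p log P = ord_p c = 0` and `log P = (crd P)·log g` with both
factors `p`-integral, so `ord_p (crd P) = 0`; then x11b's rank-one bookkeeping.)
[cite: KrizLi2019, Rem. 1.17 (p. 6), Rem. 3.10 (p. 26) and §10.3 (the index from the logarithm)]
[cite: Kim2022StructureSelmer, Lemma 3.10 (PDF p. 17)] -/
theorem padicValNat_index_eq_zero_of_not_dvd_manin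
    (W : WeierstrassCurve ℚ) [W.IsElliptic] [W.IsGloballyMinimal] (p : ℕ) [Fact p.Prime]
    [NeZero (W.conductorNorm ℤ)] (D : ModularParametrizationData W (W.conductorNorm ℤ))
    {K : Type} [Field K] [NumberField K] (ιp : K →+* ℚ_[p])
    (P : (W.baseChange K).toAffine.Point)
    (hunit : ‖((KrizLi2019.nsPointCount W p : ℤ) : ℚ_[p]) / (p : ℚ_[p]) *
        (Castella2018.padicLogOmega W p ιp P / (D.maninConstant : ℚ_[p]))‖ = 1)
    (hns : KrizLi2019.nsPointCount W p = p)
    (hadd : Addv W p) (hp : 5 ≤ p)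
    [Finite (AddCommGroup.torsion (W.baseChange K).toAffine.Point)]
    (crd : (W.baseChange K).toAffine.Point →+ ℤ) (g : (W.baseChange K).toAffine.Point)
    (hg : crd g = 1) (hker : ∀ x, crd x = 0 → IsOfFinAddOrder x)
    (hiv : ∀ x : (W.baseChange K).toAffine.Point, p • x = 0 → x = 0)
    (hc : ¬ (p : ℤ) ∣ D.c) :
    padicValNat p (AddSubgroup.zmultiples P).index = 0 := by
  -- (a) the unit statement in `ord_p` bookkeeping, with `ord_p |Ẽ^{ns}| = 1` and `ord_p c = 0`
  obtain ⟨hL0, hc0, -, hsum⟩ := KrizLi2019.padicLogOrd_eq_of_norm_eq_one hunit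
  have hns1 : padicValInt p (KrizLi2019.nsPointCount W p) = 1 := by
    rw [hns]; exact padicValInt_self
  have hvc : padicValInt p D.c = 0 := padicValInt.eq_zero_of_not_dvd hc
  have hordL : (Castella2018.padicLogOmega W p ιp P).valuation = 0 := by
    rw [Castella2018.valuation_padicLogOmega hL0]
    rw [hns1] at hsum
    change ((1 : ℕ) : ℤ) - 1 + padicLogOrd W p ιp P - (padicValInt p D.c : ℤ) = 0 at hsum
    rw [hvc] at hsum
    push_cast at hsum
    linarith
  -- (b) `log_ω P = (crd P) · log_ω g`
  set φ : (W.baseChange K).toAffine.Point →+ ℚ_[p] :=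
    (Additive.LocalLog.padicLog (W.baseChange ℚ_[p])).comp
      (WeierstrassCurve.Affine.Point.map ιp.toRatAlgHom) with hφ
  have hφ' : ∀ Q : (W.baseChange K).toAffine.Point, Castella2018.padicLogOmega W p ιp Q = φ Q :=
    fun Q => by rw [O5.HeegnerLogTransport.padicLogOmega_eq_padicLog]; rfl
  have ht : IsOfFinAddOrder (P - crd P • g) :=
    X11b.RankOne.isOfFinAddOrder_sub_coord_zsmul crd g hg hker P
  have hφt : φ (P - crd P • g) = 0 := by
    have h1 : IsOfFinAddOrder (WeierstrassCurve.Affine.Point.map ιp.toRatAlgHom (P - crd P • g)) :=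
      AddMonoidHom.isOfFinAddOrder _ ht
    rw [hφ, AddMonoidHom.comp_apply, Additive.LocalLog.padicLog_eq_zero_iff]
    exact h1
  have hdec : Castella2018.padicLogOmega W p ιp P =
      ((crd P : ℤ) : ℚ_[p]) * Castella2018.padicLogOmega W p ιp g := by
    rw [hφ' P, hφ' g]
    have hP' : P = crd P • g + (P - crd P • g) := by abel
    conv_lhs => rw [hP']
    rw [map_add, hφt, add_zero, map_zsmul, zsmul_eq_mul]
  -- (c) `crd P ≠ 0` and `log_ω g ≠ 0` (else `log_ω P = 0`)
  have hP0 : crd P ≠ 0 := by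
    intro h0
    apply hL0
    rw [hdec, h0, Int.cast_zero, zero_mul]
  have hLg0 : Castella2018.padicLogOmega W p ιp g ≠ 0 := by
    intro h0
    apply hL0
    rw [hdec, h0, mul_zero]
  -- (d) both factors are `p`-integral and the product has `ord_p = 0`, so `ord_p (crd P) = 0`
  have hvg : 0 ≤ (Castella2018.padicLogOmega W p ιp g).valuation :=
    (Padic.norm_le_one_iff_val_nonneg _).mp (norm_padicLogOmega_le_one_of_addv W p hadd hp ιp g)
  have hc' : ((crd P : ℤ) : ℚ_[p]) ≠ 0 := by exact_mod_cast hP0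
  have hvsum : (padicValInt p (crd P) : ℤ) + (Castella2018.padicLogOmega W p ιp g).valuation = 0 := by
    have h := hordL
    rw [hdec, Padic.valuation_mul hc' hLg0, Padic.valuation_intCast] at h
    exact h
  have hval : padicValInt p (crd P) = 0 := by
    have h0 : (0 : ℤ) ≤ (padicValInt p (crd P) : ℤ) := by exact_mod_cast Nat.zero_le _
    have : (padicValInt p (crd P) : ℤ) = 0 := by linarith
    exact_mod_cast this
  -- (e) `ord_p [E(K) : ℤP] = ord_p |crd P|`
  rw [X11b.RankOne.padicValNat_index_zmultiples_eq crd g hg hker hiv P hP0]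
  exact hval

/-- **T-U2′ in the shape of T-U0's binder `hI`**: under the hypotheses of
`padicValNat_index_eq_zero_of_not_dvd_manin`, `ord_p [E(K) : ℤP] = ord_p c` (both sides are `0`).
[cite: KrizLi2019, Rem. 3.10 (p. 26) and §10.3] -/
theorem padicValNat_index_eq_padicValInt_manin_of_not_dvd
    (W : WeierstrassCurve ℚ) [W.IsElliptic] [W.IsGloballyMinimal] (p : ℕ) [Fact p.Prime]
    [NeZero (W.conductorNorm ℤ)] (D : ModularParametrizationData W (W.conductorNorm ℤ))
    {K : Type} [Field K] [NumberField K] (ιp : K →+* ℚ_[p])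
    (P : (W.baseChange K).toAffine.Point)
    (hunit : ‖((KrizLi2019.nsPointCount W p : ℤ) : ℚ_[p]) / (p : ℚ_[p]) *
        (Castella2018.padicLogOmega W p ιp P / (D.maninConstant : ℚ_[p]))‖ = 1)
    (hns : KrizLi2019.nsPointCount W p = p)
    (hadd : Addv W p) (hp : 5 ≤ p)
    [Finite (AddCommGroup.torsion (W.baseChange K).toAffine.Point)]
    (crd : (W.baseChange K).toAffine.Point →+ ℤ) (g : (W.baseChange K).toAffine.Point)
    (hg : crd g = 1) (hker : ∀ x, crd x = 0 → IsOfFinAddOrder x)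
    (hiv : ∀ x : (W.baseChange K).toAffine.Point, p • x = 0 → x = 0)
    (hc : ¬ (p : ℤ) ∣ D.c) :
    padicValNat p (AddSubgroup.zmultiples P).index = padicValInt p D.c := by
  rw [padicValNat_index_eq_zero_of_not_dvd_manin W p D ιp P hunit hns hadd hp crd g hg hker hiv hc,
    padicValInt.eq_zero_of_not_dvd hc]

/-- **T-U2′ from the two named facts** (Rem. 3.10 = `hRem` BY NAME, and the CONCLUSION `hne` of
Thm. 1.20 instantiated by the caller): at the Heegner point `P ∈ E(K)` of Thm. 1.16's setting,
with `|Ẽ^{ns}(𝔽_p)| = p`, `Addv W p`, `5 ≤ p`, the rank-one coordinate data and `p ∤ c`: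
`ord_p [E(K) : ℤP] = ord_p c` — T-U0's binder `hI` with `hg0` replaced by `hc`.
[cite: KrizLi2019, Thm. 1.20 (pp. 7–8), Rem. 3.10 (p. 26), Rem. 1.21 (p. 8)] -/
theorem heegnerIndexVal_eq_maninVal_of_rem310_of_not_dvd
    (hRem : KrizLi2019.rem310_padicLogHeegner_integral)
    (W : WeierstrassCurve ℚ) [W.IsElliptic] [W.IsGloballyMinimal] (p : ℕ) [Fact p.Prime]
    [NeZero (W.conductorNorm ℤ)] (D : ModularParametrizationData W (W.conductorNorm ℤ))
    {K : Type} [Field K] [NumberField K] (hK : IsImaginaryQuadratic K)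
    (hH : SatisfiesHeegnerHypothesis (W.conductorNorm ℤ) K)
    (hsplit : ((Ideal.span {(p : ℤ)}).primesOver (𝓞 K)).ncard = 2)
    (H : HeegnerDatum (W.conductorNorm ℤ) (NumberField.discr K)) (ι : K →+* ℂ) (ιp : K →+* ℚ_[p])
    (P : (W.baseChange K).toAffine.Point)
    (hP : WeierstrassCurve.Affine.Point.map ι.toRatAlgHom P = heegnerPointComplex D H)
    (hne : ¬ ‖((KrizLi2019.nsPointCount W p : ℤ) : ℚ_[p]) / (p : ℚ_[p]) *
        (Castella2018.padicLogOmega W p ιp P / (D.maninConstant : ℚ_[p]))‖ ≤ (p : ℝ)⁻¹)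
    (hns : KrizLi2019.nsPointCount W p = p)
    (hadd : Addv W p) (hp : 5 ≤ p)
    [Finite (AddCommGroup.torsion (W.baseChange K).toAffine.Point)]
    (crd : (W.baseChange K).toAffine.Point →+ ℤ) (g : (W.baseChange K).toAffine.Point)
    (hg : crd g = 1) (hker : ∀ x, crd x = 0 → IsOfFinAddOrder x)
    (hiv : ∀ x : (W.baseChange K).toAffine.Point, p • x = 0 → x = 0)
    (hc : ¬ (p : ℤ) ∣ D.c) :
    padicValNat p (AddSubgroup.zmultiples P).index = padicValInt p D.c :=
  padicValNat_index_eq_padicValInt_manin_of_not_dvd W p D ιp P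
    (KrizLi2019.norm_eq_one_of_rem310 hRem D hK hH hsplit H ι ιp hP hne) hns hadd hp crd g hg hker
    hiv hc

end Summit.BirchSwinnertonDyer.Rank1Residual.X12.O11.RouteU

end
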